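import Literature.NumberTheory.ComplexMultiplication.MainTheoremCMLevelUniformization
import Literature.NumberTheory.ComplexMultiplication.MainTheoremCMLevelTorsionTransport
import Literature.NumberTheory.ComplexMultiplication.MainTheoremCMLevelArithmetic
import HarnessLib

/-!
# Main theorem of complex multiplication — the level-`N` uniformisation assembled from its parts (Shimura 1998, §18.6)

[Shimura1998] G. Shimura, *Abelian varieties with complex multiplication and modular functions*, Princeton 1998,
§18.6, proof of Thm. 18.6, pp. 127–129 («for `u ∈ N⁻¹𝔞/𝔞` … `ξ(u)^σ = ξ′(g(s)⁻¹u)`», (∗∗), (∗∗∗),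
«`X^σ` corresponds to `(g(d)g(d)^ρ)⁻¹pζ` with respect to `ξ′`»).

Topic `Literature/NumberTheory/ComplexMultiplication`, namespace `Literature.NumberTheory.ComplexMultiplication`.
Cell `hodgecm-mathlib` (D-0151), fan B-II, line `b2-main-theorem-cm` (crux `stmt-HodgeConjecture-24834`), row II-1 S7a
(`levelStructure`, junction file `MainTheoremCMLevelUniformization`), piece «G12 TAIL» of the S7a plan
(`PREP-II1-S7a-levelStructure.md`, harness `S7aHarness-levelStructure.lean`): THEOREMS ONLY, no definition, no named
fact, no instance.

## What is here

`exists_isLevelUniformization_of_parts` — the JUNCTION CONSTRUCTOR.  In the binders of `levelStructure` (a model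
`(A₀, ι₀)` over `L ⊂ ℂ`, a divisor `X`, a uniformisation `ξ` of `A₀ ⊗ ℂ` of type `(K, Φ; 𝔞)`, `σ ∈ Aut(ℂ/K*)`, an idèle
`s` of `K*` with `𝔟 = g(s)_𝐡⁻¹𝔞`, a prime `ℓ`, a level `N > 0` with `ℓ ∣ N`) and given
* the raw input of the TT-idèle theorem at modulus `(N)`: a finite prime `𝔭 ∤ N` of `K*`, a prime element `ϖ` at `𝔭`,
  and «`[s, K*] = Frob_𝔭` on the ray class field `C_N`» (supplied by G4 from `IsArtinLift K* s σ` and a Frobenius prime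
  `𝔓 ∣ 𝔭` of the common field, [Shimura1998] p. 128 (3));
* the lattice `𝔠 = g(c)_𝐡⁻¹𝔞` of Shimura's prime idèle `c` at `𝔭` (G6: `𝔠 = 𝔮⁻¹𝔞`, `𝔮 = g(𝔭)`, the type of the
  structure `(A_i, ι_i)`, p. 127);
* a uniformisation `ξ₂` of the junction carrier `(A₀ ⊗ ℂ)^σ` of type `(K, Φ; 𝔠)` with «`ξ(u)^σ = ξ₂(u)` for
  `u ∈ N⁻¹𝔞`» (G11a: `σ` acts on `A[N]` as `κ = θ ∘ λ`, and `κ ∘ ξ = ξ₂`, pp. 127–128);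
* the relative polarisation clause for every reindex `ξ′ = ξ₂ ∘ (β·)` of `ξ₂` to type `𝔟` with `𝔠 = (β)𝔟`
  (G11b: S5 transported along `(A₀^γ) ⊗ ℂ ≅ (A₀ ⊗ ℂ)^σ`, pp. 128–129),
THERE ARE `ξ′, q, β` with `IsLevelUniformization Φ 𝔞 𝔟 A₀ ι₀ X πA ξ σ s πσ ℓ N ξ′ q β ν` for the LEVEL-INDEPENDENT
`ν := N((s_𝐡)) ∈ ℚ ⊂ K`.  PROOF (pp. 128–129): the TT-idèle theorem
`exists_reflexNorm_torsionCongruence_of_abRestrict_ideleArtinMap_eq_galFrob` gives `d₀ ∈ K*^×` with the torsion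
congruence «`g(s)_𝐡⁻¹(u mod 𝔞) = (g(d₀)u mod 𝔟)`», the lattice identity `g(c)_𝐡⁻¹𝔞 = g(d₀)⁻¹𝔟` and the norm
identity `N((s_𝐡))N((d₀)) = N𝔭`; put `q := N𝔭`, `β := g(d₀)⁻¹` (so `𝔠 = (β)𝔟`); `levelArithmetic_of_latticeIdentity`
(B-p19) gives `β ≠ 0`, `0 < q`, `qββ^ρ = ν`, `𝔞 ≤ (β)𝔟` and the `t`-clause; the torsion transport
`CMTypeUniformization.exists_reindex_forall_conj_eq_of_torsionCongruence_units` gives `ξ′ := ξ₂ ∘ (β·)` of type `𝔟`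
with clause (2)_N; the polarisation clause is the hypothesis schema at `(β, ξ′)`.

## References

* [Shimura1998] G. Shimura, *Abelian Varieties with Complex Multiplication and Modular Functions*, Princeton 1998,
  §18.6 Thm. 18.6 (pp. 124–125) and its proof (pp. 125–129).
-/

noncomputable section

open CategoryTheory CategoryTheory.Limits AlgebraicGeometry NumberField IsDedekindDomain
open scoped NumberField nonZeroDivisors
open Literature.AlgebraicGeometry.Motives Literature.AlgebraicGeometry.Motives.AbelianVariety
open Literature.NumberTheory.NumberFields
open Literature.AlgebraicGeometry.ComplexMultiplication
open Literature.NumberTheory.GaloisRepresentations (ideleGroup localUnits galFrob)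
open Literature.NumberTheory.Automorphic.FiniteAdeleRing (toFractionalIdeal)
open FractionalIdeal (spanSingleton)

namespace Literature.NumberTheory.ComplexMultiplication

/-- **The level-`N` uniformisation from its parts** ([Shimura1998] §18.6, proof of Thm. 18.6, pp. 128–129,
(∗∗) p. 128, (∗∗∗) p. 129): in the binders of `levelStructure`, from (i) the TT-idèle input at modulus `(N)` — a prime `𝔭 ∤ N` of `K*`,
a prime element `ϖ` at `𝔭`, «`[s, K*]|_{C_N} = Frob_𝔭`»; (ii) the lattice `𝔠 = g(c)_𝐡⁻¹𝔞` of the prime idèle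
`c = localUnits 𝔭 ϖ`; (iii) a uniformisation `ξ₂` of `(A₀ ⊗ ℂ)^σ` of type `(K, Φ; 𝔠)` with «`ξ(u)^σ = ξ₂(u)` for
`N u ∈ 𝔞`»; (iv) the relative polarisation clause for every reindex `ξ′ = ξ₂ ∘ (β·)` of type `𝔟`, `𝔠 = (β)𝔟`, with
exponent `q = N𝔭` — there are `ξ′, q, β` with `IsLevelUniformization … N ξ′ q β ν`, `ν = N((s_𝐡))`
(`q := N𝔭`, `β := g(d₀)⁻¹` for the TT-idèle's `d₀`, `ξ′ := ξ₂ ∘ (β·)`).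
[cite: Shimura1998, §18.6 proof of Thm. 18.6, pp. 128–129 ((∗∗) p. 128, (∗∗∗) p. 129)] -/
theorem exists_isLevelUniformization_of_parts
    {K : Type} [Field K] [NumberField K] [IsCMField K] (Φ : CMType K) [NumberField (traceField Φ)]
    (𝔞 𝔟 : (FractionalIdeal (𝓞 K)⁰ K)ˣ)
    {L : Type} [Field L] [NumberField L] [Algebra L ℂ] (A₀ : AbelianVariety L) (ι₀ : 𝓞 K →+* End A₀)
    (X : CartierDivisor A₀.X.left)
    (πA : (A₀.baseChange ℂ).X.left ⟶ A₀.X.left) [IsDominant πA]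
    (ξ : CMTypeUniformization Φ 𝔞 (A₀.baseChange ℂ) ((endBaseChange ℂ A₀).comp ι₀))
    (σ : ℂ ≃ₐ[traceField Φ] ℂ) (s : ideleGroup (traceField Φ))
    (h𝔟 : 𝔟 = ideleMulIdealUnits (reflexNormFinitePart K Φ (traceField Φ) s)⁻¹ 𝔞)
    (πσ : ((A₀.baseChange ℂ).conjugate σ.toRingEquiv).X.left ⟶ (A₀.baseChange ℂ).X.left) [IsDominant πσ]
    (ℓ : ℕ) [∀ k : ℕ, IsDominant (Hom.toSchemeHom (((ℓ ^ k : ℕ) : ℤ) • 𝟙 (A₀.baseChange ℂ)))]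
    [∀ k : ℕ, IsDominant (Hom.toSchemeHom (((ℓ ^ k : ℕ) : ℤ) • 𝟙 ((A₀.baseChange ℂ).conjugate σ.toRingEquiv)))]
    {N : ℕ} (hN : 0 < N) (hℓN : ℓ ∣ N)
    -- (i) the TT-idèle input at modulus `(N)`
    {𝔭 : HeightOneSpectrum (𝓞 (traceField Φ))}
    (h𝔭N : ¬ Ideal.span {(N : 𝓞 (traceField Φ))} ≤ 𝔭.asIdeal)
    {ϖ : (𝔭.adicCompletion (traceField Φ))ˣ}
    (hϖ : Valued.v (ϖ : 𝔭.adicCompletion (traceField Φ)) = WithZero.exp (-1 : ℤ))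
    (hsFrob : abRestrict (rayClassField (traceField Φ) (Ideal.span {(N : 𝓞 (traceField Φ))}))
        (ideleArtinMap (traceField Φ) s) =
      galFrob (traceField Φ) (rayClassField (traceField Φ) (Ideal.span {(N : 𝓞 (traceField Φ))})) 𝔭)
    -- (ii) the lattice of Shimura's prime idèle `c`
    (𝔠 : (FractionalIdeal (𝓞 K)⁰ K)ˣ)
    (h𝔠 : IdeleAction.ideleMulIdeal
        (reflexNormFiniteIdele K Φ (traceField Φ) (IdeleAction.finitePart (traceField Φ) (localUnits 𝔭 ϖ)))⁻¹
        (𝔞 : FractionalIdeal (𝓞 K)⁰ K) = (𝔠 : FractionalIdeal (𝓞 K)⁰ K))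
    -- (iii) the uniformisation of the junction carrier through which `σ` factors on the `N`-torsion
    (ξ₂ : CMTypeUniformization Φ 𝔠 ((A₀.baseChange ℂ).conjugate σ.toRingEquiv)
      (((A₀.baseChange ℂ).endConjugate σ.toRingEquiv).comp ((endBaseChange ℂ A₀).comp ι₀)))
    (hF : ∀ u : K, ((N : ℕ) : K) * u ∈ (𝔞 : FractionalIdeal (𝓞 K)⁰ K) →
      (A₀.baseChange ℂ).conjPoints σ.toRingEquiv (ξ.r u) = ξ₂.r u)
    -- (iv) the relative polarisation clause for every reindex of `ξ₂` to type `𝔟`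
    (hPAIR : ∀ (β : K) (ξ' : CMTypeUniformization Φ 𝔟 ((A₀.baseChange ℂ).conjugate σ.toRingEquiv)
        (((A₀.baseChange ℂ).endConjugate σ.toRingEquiv).comp ((endBaseChange ℂ A₀).comp ι₀))),
      (𝔠 : FractionalIdeal (𝓞 K)⁰ K) = spanSingleton (𝓞 K)⁰ β * (𝔟 : FractionalIdeal (𝓞 K)⁰ K) →
      (∀ w : K, ξ'.r w = ξ₂.r (β * w)) →
      ∀ (k : ℕ) (u w x y : K) (hu : ((ℓ ^ k : ℕ) : K) * u ∈ (𝔟 : FractionalIdeal (𝓞 K)⁰ K))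
        (hw : ((ℓ ^ k : ℕ) : K) * w ∈ (𝔟 : FractionalIdeal (𝓞 K)⁰ K))
        (hx : ((ℓ ^ k : ℕ) : K) * x ∈ (𝔞 : FractionalIdeal (𝓞 K)⁰ K))
        (hy : ((ℓ ^ k : ℕ) : K) * y ∈ (𝔞 : FractionalIdeal (𝓞 K)⁰ K)),
        x - β * u ∈ FractionalIdeal.spanSingleton (𝓞 K)⁰ β * (𝔟 : FractionalIdeal (𝓞 K)⁰ K) →
        y - β * w ∈ FractionalIdeal.spanSingleton (𝓞 K)⁰ β * (𝔟 : FractionalIdeal (𝓞 K)⁰ K) →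
        ((A₀.baseChange ℂ).conjugate σ.toRingEquiv).weilPairingLevel ((X.pullback πA).pullback πσ)
            ⟨ξ'.r u, ξ'.r_nsmul_mem _ u hu⟩ ⟨ξ'.r w, ξ'.r_nsmul_mem _ w hw⟩ =
          ((A₀.baseChange ℂ).weilPairingLevel (X.pullback πA)
            ⟨ξ.r x, ξ.r_nsmul_mem _ x hx⟩ ⟨ξ.r y, ξ.r_nsmul_mem _ y hy⟩) ^ Ideal.absNorm 𝔭.asIdeal) :
    ∃ (ξ' : CMTypeUniformization Φ 𝔟 ((A₀.baseChange ℂ).conjugate σ.toRingEquiv)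
        (((A₀.baseChange ℂ).endConjugate σ.toRingEquiv).comp ((endBaseChange ℂ A₀).comp ι₀)))
      (q : ℕ) (β : K),
      IsLevelUniformization Φ 𝔞 𝔟 A₀ ι₀ X πA ξ σ s πσ ℓ N ξ' q β
        ((FractionalIdeal.absNorm (toFractionalIdeal (𝓞 (traceField Φ)) (traceField Φ)
          (IdeleAction.finitePart (traceField Φ) s)) : ℚ) : K) := by
  classical
  -- `𝔟 = g(s)_𝐡⁻¹𝔞` is a definitional abbreviation of the junction: substitute it
  subst h𝔟
  -- the junction's finite idèle `t₀ = g(s)_𝐡⁻¹`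
  set t₀ : (FiniteAdeleRing (𝓞 K) K)ˣ := (reflexNormFinitePart K Φ (traceField Φ) s)⁻¹ with ht₀
  have hN0 : N ≠ 0 := hN.ne'
  have hk : traceField Φ ≤ traceField Φ := le_rfl
  -- the TT-idèle theorem: `d₀`, the torsion congruence (2), the lattice identity (3), the norm identity (4)
  obtain ⟨d₀, -, h2, h3, h4⟩ :=
    exists_reflexNorm_torsionCongruence_of_abRestrict_ideleArtinMap_eq_galFrob K Φ (traceField Φ) hN0 h𝔭N hϖ
      hsFrob
  -- the five arithmetic conjuncts of the level (β := g(d₀)⁻¹, q := N𝔭, ν := N((s_𝐡)))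
  obtain ⟨hβ0, hq0, hν, h𝔞le, ht⟩ :=
    levelArithmetic_of_latticeIdentity K Φ (traceField Φ) hk hN0 hℓN h𝔭N hϖ (h3 (𝔞 : FractionalIdeal (𝓞 K)⁰ K)) h4
  have h3𝔞 := h3 (𝔞 : FractionalIdeal (𝓞 K)⁰ K)
  -- read everything through the junction's idèle `t₀` (`g(s)_𝐡 = g_f(s_𝐡)`)
  have hts : (reflexNormFiniteIdele K Φ (traceField Φ) (IdeleAction.finitePart (traceField Φ) s))⁻¹ = t₀ := by
    rw [ht₀, reflexNormFinitePart_eq]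
  rw [hts] at h2 h3𝔞 h𝔞le ht
  -- notation `g := g(d₀)`
  set g : K := reflexNormFrom K Φ (traceField Φ) d₀ with hg_def
  have hd₀ : ((d₀ : (traceField Φ)ˣ) : traceField Φ) ≠ 0 := d₀.ne_zero
  have hg0 : g ≠ 0 := reflexNormFrom_ne_zero K Φ (traceField Φ) hd₀
  -- the lattice of `c`: `𝔠 = g(d₀)⁻¹ · t₀𝔞`, i.e. `t₀𝔞 = g(d₀) · 𝔠`
  have h𝔠β : (𝔠 : FractionalIdeal (𝓞 K)⁰ K) =
      spanSingleton (𝓞 K)⁰ g⁻¹ * IdeleAction.ideleMulIdeal t₀ (𝔞 : FractionalIdeal (𝓞 K)⁰ K) := by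
    rw [← h𝔠, h3𝔞]
  have ht𝔞 : IdeleAction.ideleMulIdeal t₀ (𝔞 : FractionalIdeal (𝓞 K)⁰ K) =
      spanSingleton (𝓞 K)⁰ (g * (1 : K)⁻¹) * (𝔠 : FractionalIdeal (𝓞 K)⁰ K) := by
    rw [inv_one, mul_one, h𝔠β, ← mul_assoc, FractionalIdeal.spanSingleton_mul_spanSingleton,
      mul_inv_cancel₀ hg0, FractionalIdeal.spanSingleton_one, one_mul]
  -- the torsion transport: `ξ′ := ξ₂ ∘ (g(d₀)⁻¹·)` of type `t₀𝔞`, with clause (2)_N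
  obtain ⟨ξ', h2N, -, hre⟩ :=
    CMTypeUniformization.exists_reindex_forall_conj_eq_of_torsionCongruence_units ξ ξ₂
      ((A₀.baseChange ℂ).conjPoints σ.toRingEquiv) t₀ (N := N) (b := (1 : K)) (g := g) one_ne_zero hg0
      (fun u hu => by rw [one_mul]; exact hF u hu) (fun u hu => h2 _ 𝔞.ne_zero u hu) ht𝔞
  -- assemble the junction predicate
  refine ⟨ξ', Ideal.absNorm 𝔭.asIdeal, g⁻¹, ?_⟩
  unfold IsLevelUniformization
  refine ⟨h2N, hβ0, hq0, hν, ?_, ?_, ?_⟩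
  · -- `𝔞 ≤ (β)𝔟`
    simpa only [coe_ideleMulIdealUnits] using h𝔞le
  · -- the `t`-clause
    simpa only [coe_ideleMulIdealUnits] using ht
  · -- the relative polarisation clause, from the schema at `(β, ξ′)`
    refine hPAIR g⁻¹ ξ' ?_ ?_
    · rw [coe_ideleMulIdealUnits]
      exact h𝔠β
    · intro w
      rw [hre w, inv_one, mul_one]

/-- **The level-`N` uniformisation from its parts, «`σ = κ` on the `N`-torsion» form** ([Shimura1998] §18.6, proof of
Thm. 18.6, p. 128: «`t^σ = κt` for every `t ∈ A[N]`» and «`ξ(u)^σ = κ(ξ(u)) = ξ*(u)`»): the same as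
`exists_isLevelUniformization_of_parts` with hypothesis (iii) split as the crew delivers it — a points map `G`
(the κ-read on the junction carrier, `G = (E ∘ κ_ℂ)` on `ℂ`-points) agreeing with `x ↦ x^σ` on `(A₀ ⊗ ℂ)[N](ℂ)`
(`hFG`, from the geometric torsion clause of the specialisation data) and carrying `ξ` to `ξ₂` (`hG`, from
`κ ∘ ξ = ξ* ` — the `𝔮`-multiplication followed by `θ`).
[cite: Shimura1998, §18.6 proof of Thm. 18.6, pp. 127–129] -/
theorem exists_isLevelUniformization_of_parts_of_eq_on_torsion
    {K : Type} [Field K] [NumberField K] [IsCMField K] (Φ : CMType K) [NumberField (traceField Φ)]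
    (𝔞 𝔟 : (FractionalIdeal (𝓞 K)⁰ K)ˣ)
    {L : Type} [Field L] [NumberField L] [Algebra L ℂ] (A₀ : AbelianVariety L) (ι₀ : 𝓞 K →+* End A₀)
    (X : CartierDivisor A₀.X.left)
    (πA : (A₀.baseChange ℂ).X.left ⟶ A₀.X.left) [IsDominant πA]
    (ξ : CMTypeUniformization Φ 𝔞 (A₀.baseChange ℂ) ((endBaseChange ℂ A₀).comp ι₀))
    (σ : ℂ ≃ₐ[traceField Φ] ℂ) (s : ideleGroup (traceField Φ))
    (h𝔟 : 𝔟 = ideleMulIdealUnits (reflexNormFinitePart K Φ (traceField Φ) s)⁻¹ 𝔞)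
    (πσ : ((A₀.baseChange ℂ).conjugate σ.toRingEquiv).X.left ⟶ (A₀.baseChange ℂ).X.left) [IsDominant πσ]
    (ℓ : ℕ) [∀ k : ℕ, IsDominant (Hom.toSchemeHom (((ℓ ^ k : ℕ) : ℤ) • 𝟙 (A₀.baseChange ℂ)))]
    [∀ k : ℕ, IsDominant (Hom.toSchemeHom (((ℓ ^ k : ℕ) : ℤ) • 𝟙 ((A₀.baseChange ℂ).conjugate σ.toRingEquiv)))]
    {N : ℕ} (hN : 0 < N) (hℓN : ℓ ∣ N)
    -- (i) the TT-idèle input at modulus `(N)`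
    {𝔭 : HeightOneSpectrum (𝓞 (traceField Φ))}
    (h𝔭N : ¬ Ideal.span {(N : 𝓞 (traceField Φ))} ≤ 𝔭.asIdeal)
    {ϖ : (𝔭.adicCompletion (traceField Φ))ˣ}
    (hϖ : Valued.v (ϖ : 𝔭.adicCompletion (traceField Φ)) = WithZero.exp (-1 : ℤ))
    (hsFrob : abRestrict (rayClassField (traceField Φ) (Ideal.span {(N : 𝓞 (traceField Φ))}))
        (ideleArtinMap (traceField Φ) s) =
      galFrob (traceField Φ) (rayClassField (traceField Φ) (Ideal.span {(N : 𝓞 (traceField Φ))})) 𝔭)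
    -- (ii) the lattice of Shimura's prime idèle `c`
    (𝔠 : (FractionalIdeal (𝓞 K)⁰ K)ˣ)
    (h𝔠 : IdeleAction.ideleMulIdeal
        (reflexNormFiniteIdele K Φ (traceField Φ) (IdeleAction.finitePart (traceField Φ) (localUnits 𝔭 ϖ)))⁻¹
        (𝔞 : FractionalIdeal (𝓞 K)⁰ K) = (𝔠 : FractionalIdeal (𝓞 K)⁰ K))
    -- (iii) `ξ₂` and the κ-read `G` with «`x^σ = G x` on `A[N](ℂ)`» and «`G ∘ ξ = ξ₂`»
    (ξ₂ : CMTypeUniformization Φ 𝔠 ((A₀.baseChange ℂ).conjugate σ.toRingEquiv)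
      (((A₀.baseChange ℂ).endConjugate σ.toRingEquiv).comp ((endBaseChange ℂ A₀).comp ι₀)))
    (G : (A₀.baseChange ℂ).Points ℂ → ((A₀.baseChange ℂ).conjugate σ.toRingEquiv).Points ℂ)
    (hFG : ∀ P : (A₀.baseChange ℂ).Points ℂ, P ∈ (A₀.baseChange ℂ).torsionPoints ℂ (N : ℤ) →
      (A₀.baseChange ℂ).conjPoints σ.toRingEquiv P = G P)
    (hG : ∀ u : K, G (ξ.r u) = ξ₂.r u)
    -- (iv) the relative polarisation clause for every reindex of `ξ₂` to type `𝔟`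
    (hPAIR : ∀ (β : K) (ξ' : CMTypeUniformization Φ 𝔟 ((A₀.baseChange ℂ).conjugate σ.toRingEquiv)
        (((A₀.baseChange ℂ).endConjugate σ.toRingEquiv).comp ((endBaseChange ℂ A₀).comp ι₀))),
      (𝔠 : FractionalIdeal (𝓞 K)⁰ K) = spanSingleton (𝓞 K)⁰ β * (𝔟 : FractionalIdeal (𝓞 K)⁰ K) →
      (∀ w : K, ξ'.r w = ξ₂.r (β * w)) →
      ∀ (k : ℕ) (u w x y : K) (hu : ((ℓ ^ k : ℕ) : K) * u ∈ (𝔟 : FractionalIdeal (𝓞 K)⁰ K))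
        (hw : ((ℓ ^ k : ℕ) : K) * w ∈ (𝔟 : FractionalIdeal (𝓞 K)⁰ K))
        (hx : ((ℓ ^ k : ℕ) : K) * x ∈ (𝔞 : FractionalIdeal (𝓞 K)⁰ K))
        (hy : ((ℓ ^ k : ℕ) : K) * y ∈ (𝔞 : FractionalIdeal (𝓞 K)⁰ K)),
        x - β * u ∈ FractionalIdeal.spanSingleton (𝓞 K)⁰ β * (𝔟 : FractionalIdeal (𝓞 K)⁰ K) →
        y - β * w ∈ FractionalIdeal.spanSingleton (𝓞 K)⁰ β * (𝔟 : FractionalIdeal (𝓞 K)⁰ K) →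
        ((A₀.baseChange ℂ).conjugate σ.toRingEquiv).weilPairingLevel ((X.pullback πA).pullback πσ)
            ⟨ξ'.r u, ξ'.r_nsmul_mem _ u hu⟩ ⟨ξ'.r w, ξ'.r_nsmul_mem _ w hw⟩ =
          ((A₀.baseChange ℂ).weilPairingLevel (X.pullback πA)
            ⟨ξ.r x, ξ.r_nsmul_mem _ x hx⟩ ⟨ξ.r y, ξ.r_nsmul_mem _ y hy⟩) ^ Ideal.absNorm 𝔭.asIdeal) :
    ∃ (ξ' : CMTypeUniformization Φ 𝔟 ((A₀.baseChange ℂ).conjugate σ.toRingEquiv)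
        (((A₀.baseChange ℂ).endConjugate σ.toRingEquiv).comp ((endBaseChange ℂ A₀).comp ι₀)))
      (q : ℕ) (β : K),
      IsLevelUniformization Φ 𝔞 𝔟 A₀ ι₀ X πA ξ σ s πσ ℓ N ξ' q β
        ((FractionalIdeal.absNorm (toFractionalIdeal (𝓞 (traceField Φ)) (traceField Φ)
          (IdeleAction.finitePart (traceField Φ) s)) : ℚ) : K) :=
  exists_isLevelUniformization_of_parts Φ 𝔞 𝔟 A₀ ι₀ X πA ξ σ s h𝔟 πσ ℓ hN hℓN h𝔭N hϖ hsFrob 𝔠 h𝔠 ξ₂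
    (fun u hu => by rw [hFG (ξ.r u) (ξ.r_nsmul_mem N u hu), hG u]) hPAIR

end Literature.NumberTheory.ComplexMultiplication

end
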